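import Mathlib

/-!
# PercRepro — BINOMIAL FACTS FOR THE SLICE `#P = q − 1` OF (R̂) (p4, gen 20; Mathlib only)

The odd binomial row `C(2m+1, ·)` and one ratio monotonicity, used by RankLevelSetRuleQSliceOne:
* `sum_choose_upper_half` — `Σ_{a ≤ m} C(2m+1, m+1+a) = 4^m` (`Nat.sum_range_choose_halfway` + reflection);
* `two_mul_sum_choose_even_upper` — `2·Σ_{a ≤ m} C(2m, m+a) = 4^m + C(2m, m)`;
* `two_mul_sum_succ_mul_choose_upper` — `2·Σ_{a ≤ m} (a+1)·C(2m+1, m+1+a) = 4^m + (m+1)·C(2m+1, m+1)`;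
* `sum_succ_mul_choose_even_upper` — `Σ_{a ≤ m} (a+1)·C(2m+2, m+2+a) = (m+1)·C(2m+1, m+1)`;
* `two_mul_succ_mul_choose_le` — `2(m+1)·C(2m+1, m+1) ≤ 4^m·(m+2)` (induction on `m`);
* `choose_ratio_le_of_succ_le` — for `q ≥ 1`, `k ≥ j+1`: `C(q+k, j)·C(j+2, j) ≤ C(q+j+1, j)·C(k+1, j)`
  (the ratio `C(q+k, j)/C(k+1, j)` is non-increasing in `k`; induction on `k` with `Nat.choose_mul_succ_eq`).
Axioms: standard.
-/

namespace PercRepro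

open Finset

/-! ### §1 The odd binomial row `C(2m+1, ·)`: four facts -/

/-- Upper half of the odd row: `Σ_{a ≤ m} C(2m+1, m+1+a) = 4^m`. -/
lemma sum_choose_upper_half (m : ℕ) :
    ∑ a ∈ range (m + 1), (2 * m + 1).choose (m + 1 + a) = 4 ^ m := by
  have h := Finset.sum_range_reflect (fun a => (2 * m + 1).choose (m + 1 + a)) (m + 1)
  rw [← h, ← Nat.sum_range_choose_halfway m]
  refine Finset.sum_congr rfl (fun a ha => ?_)
  rw [Finset.mem_range] at ha
  rw [show m + 1 + (m + 1 - 1 - a) = 2 * m + 1 - a by omega]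
  exact Nat.choose_symm (by omega)

/-- The lower half of the even row, reflected: `Σ_{i < m} C(2m, i) = Σ_{a < m} C(2m, m+1+a)`. -/
lemma sum_choose_lower_eq_upper (m : ℕ) :
    ∑ i ∈ range m, (2 * m).choose i = ∑ a ∈ range m, (2 * m).choose (m + 1 + a) := by
  have h := Finset.sum_range_reflect (fun a => (2 * m).choose (m + 1 + a)) m
  rw [← h]
  refine Finset.sum_congr rfl (fun a ha => ?_)
  rw [Finset.mem_range] at ha
  rw [show m + 1 + (m - 1 - a) = 2 * m - a by omega]
  exact (Nat.choose_symm (by omega)).symm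

/-- The middle-inclusive upper half of the even row: `2·Σ_{a ≤ m} C(2m, m+a) = 4^m + C(2m, m)`. -/
lemma two_mul_sum_choose_even_upper (m : ℕ) :
    2 * ∑ a ∈ range (m + 1), (2 * m).choose (m + a) = 4 ^ m + (2 * m).choose m := by
  have hfull : ∑ i ∈ range (2 * m + 1), (2 * m).choose i = 4 ^ m := by
    rw [Nat.sum_range_choose, pow_mul]; norm_num
  have hsplit : ∑ i ∈ range (2 * m + 1), (2 * m).choose i
      = ∑ i ∈ range m, (2 * m).choose i + ∑ a ∈ range (m + 1), (2 * m).choose (m + a) := by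
    rw [show 2 * m + 1 = m + (m + 1) by ring, Finset.sum_range_add]
  have hup : ∑ a ∈ range (m + 1), (2 * m).choose (m + a)
      = (2 * m).choose m + ∑ a ∈ range m, (2 * m).choose (m + 1 + a) := by
    rw [Finset.sum_range_succ' (fun a => (2 * m).choose (m + a)) m, add_zero, add_comm]
    congr 1
    exact Finset.sum_congr rfl (fun a _ => by rw [show m + (a + 1) = m + 1 + a by ring])
  have hlow := sum_choose_lower_eq_upper m
  omega

/-- `2·Σ_{a ≤ m} (a+1)·C(2m+1, m+1+a) = 4^m + (m+1)·C(2m+1, m+1)`. -/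
lemma two_mul_sum_succ_mul_choose_upper (m : ℕ) :
    2 * ∑ a ∈ range (m + 1), (a + 1) * (2 * m + 1).choose (m + 1 + a)
      = 4 ^ m + (m + 1) * (2 * m + 1).choose (m + 1) := by
  have hterm : ∀ a, (m + 1 + a) * (2 * m + 1).choose (m + 1 + a)
      = (2 * m + 1) * (2 * m).choose (m + a) := by
    intro a
    have h := Nat.add_one_mul_choose_eq (2 * m) (m + a)
    rw [h, show m + a + 1 = m + 1 + a by ring, mul_comm]
  have hsum : ∑ a ∈ range (m + 1), (m + 1 + a) * (2 * m + 1).choose (m + 1 + a)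
      = (2 * m + 1) * ∑ a ∈ range (m + 1), (2 * m).choose (m + a) := by
    rw [Finset.mul_sum]
    exact Finset.sum_congr rfl (fun a _ => hterm a)
  have hsplit : ∑ a ∈ range (m + 1), (m + 1 + a) * (2 * m + 1).choose (m + 1 + a)
      = ∑ a ∈ range (m + 1), (a + 1) * (2 * m + 1).choose (m + 1 + a)
        + m * ∑ a ∈ range (m + 1), (2 * m + 1).choose (m + 1 + a) := by
    rw [Finset.mul_sum, ← Finset.sum_add_distrib]
    exact Finset.sum_congr rfl (fun a _ => by ring)
  have h1 := sum_choose_upper_half m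
  have h2 := two_mul_sum_choose_even_upper m
  have h3 : (2 * m + 1) * (2 * m).choose m = (m + 1) * (2 * m + 1).choose (m + 1) := by
    have h := Nat.add_one_mul_choose_eq (2 * m) m
    rw [h, mul_comm]
  set S1 := ∑ a ∈ range (m + 1), (a + 1) * (2 * m + 1).choose (m + 1 + a) with hS1
  set U := ∑ a ∈ range (m + 1), (2 * m).choose (m + a) with hU
  set C := (2 * m).choose m with hC
  set C' := (2 * m + 1).choose (m + 1) with hC'
  have e : S1 + m * 4 ^ m = (2 * m + 1) * U := by rw [← h1, ← hsplit, hsum]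
  have e5 : 2 * S1 + 2 * (m * 4 ^ m) = 2 * (m * 4 ^ m) + (4 ^ m + (m + 1) * C') := by
    calc 2 * S1 + 2 * (m * 4 ^ m) = 2 * (S1 + m * 4 ^ m) := by ring
      _ = 2 * ((2 * m + 1) * U) := by rw [e]
      _ = (2 * m + 1) * (2 * U) := by ring
      _ = (2 * m + 1) * (4 ^ m + C) := by rw [h2]
      _ = 2 * (m * 4 ^ m) + (4 ^ m + (2 * m + 1) * C) := by ring
      _ = 2 * (m * 4 ^ m) + (4 ^ m + (m + 1) * C') := by rw [h3]
  omega

/-- `Σ_{a ≤ m} (a+1)·C(2m+2, m+2+a) = (m+1)·C(2m+1, m+1)` (the `j = 1` mass). -/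
lemma sum_succ_mul_choose_even_upper (m : ℕ) :
    ∑ a ∈ range (m + 1), (a + 1) * (2 * m + 2).choose (m + 2 + a)
      = (m + 1) * (2 * m + 1).choose (m + 1) := by
  have hpascal : ∀ a, (2 * m + 2).choose (m + 2 + a)
      = (2 * m + 1).choose (m + 1 + a) + (2 * m + 1).choose (m + 2 + a) := by
    intro a
    have h := Nat.choose_succ_succ (2 * m + 1) (m + 1 + a)
    rw [Nat.succ_eq_add_one, Nat.succ_eq_add_one] at h
    rw [show 2 * m + 2 = 2 * m + 1 + 1 by ring, show m + 2 + a = m + 1 + a + 1 by ring, h]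
  have hshift : ∑ a ∈ range (m + 1), (a + 1) * (2 * m + 1).choose (m + 2 + a)
      = ∑ a ∈ range (m + 1), a * (2 * m + 1).choose (m + 1 + a) := by
    rw [Finset.sum_range_succ' (fun a => a * (2 * m + 1).choose (m + 1 + a)) m,
      Finset.sum_range_succ (fun a => (a + 1) * (2 * m + 1).choose (m + 2 + a)) m]
    rw [Nat.choose_eq_zero_of_lt (show 2 * m + 1 < m + 2 + m by omega)]
    simp only [zero_mul, add_zero, mul_zero]
    exact Finset.sum_congr rfl (fun a _ => by rw [show m + 1 + (a + 1) = m + 2 + a by ring])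
  have hsum : ∑ a ∈ range (m + 1), (a + 1) * (2 * m + 2).choose (m + 2 + a)
      = ∑ a ∈ range (m + 1), (a + 1) * (2 * m + 1).choose (m + 1 + a)
        + ∑ a ∈ range (m + 1), (a + 1) * (2 * m + 1).choose (m + 2 + a) := by
    rw [← Finset.sum_add_distrib]
    exact Finset.sum_congr rfl (fun a _ => by rw [hpascal a]; ring)
  have h4 : ∑ a ∈ range (m + 1), a * (2 * m + 1).choose (m + 1 + a)
      + ∑ a ∈ range (m + 1), (2 * m + 1).choose (m + 1 + a)
      = ∑ a ∈ range (m + 1), (a + 1) * (2 * m + 1).choose (m + 1 + a) := by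
    rw [← Finset.sum_add_distrib]
    exact Finset.sum_congr rfl (fun a _ => by ring)
  have h1 := sum_choose_upper_half m
  have h2 := two_mul_sum_succ_mul_choose_upper m
  omega

/-- `2(m+1)·C(2m+1, m+1) ≤ 4^m·(m+2)` (the central binomial against the half row; induction on `m`). -/
lemma two_mul_succ_mul_choose_le (m : ℕ) :
    2 * (m + 1) * (2 * m + 1).choose (m + 1) ≤ 4 ^ m * (m + 2) := by
  induction m with
  | zero => simp
  | succ n ih =>
    have hsym : (2 * n + 1).choose n = (2 * n + 1).choose (n + 1) := by
      rw [show 2 * n + 1 = n + (n + 1) by ring]; exact Nat.choose_symm_add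
    have hB : (2 * n + 2).choose (n + 1) = 2 * (2 * n + 1).choose (n + 1) := by
      rw [show 2 * n + 2 = 2 * n + 1 + 1 by ring, Nat.choose_succ_succ, hsym]; ring
    have hA : (n + 2) * (2 * (n + 1) + 1).choose (n + 1 + 1) = (2 * n + 3) * (2 * n + 2).choose (n + 1) := by
      have h := Nat.add_one_mul_choose_eq (2 * n + 2) (n + 1)
      rw [show 2 * (n + 1) + 1 = 2 * n + 2 + 1 by ring]
      calc (n + 2) * (2 * n + 2 + 1).choose (n + 1 + 1)
          = (2 * n + 2 + 1).choose (n + 1 + 1) * (n + 1 + 1) := by ring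
        _ = (2 * n + 2 + 1) * (2 * n + 2).choose (n + 1) := h.symm
        _ = (2 * n + 3) * (2 * n + 2).choose (n + 1) := by ring
    have key : (2 * n + 3) * (2 * n + 1).choose (n + 1) ≤ 4 ^ n * (n + 3) := by
      have h1 : (2 * n + 3) * (2 * (n + 1) * (2 * n + 1).choose (n + 1))
          ≤ (2 * n + 3) * (4 ^ n * (n + 2)) := Nat.mul_le_mul_left _ ih
      have hpoly : (2 * n + 3) * (n + 2) ≤ 2 * (n + 1) * (n + 3) := by nlinarith
      have h2 : (2 * n + 3) * (4 ^ n * (n + 2)) ≤ 2 * (n + 1) * (4 ^ n * (n + 3)) := by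
        calc (2 * n + 3) * (4 ^ n * (n + 2)) = 4 ^ n * ((2 * n + 3) * (n + 2)) := by ring
          _ ≤ 4 ^ n * (2 * (n + 1) * (n + 3)) := Nat.mul_le_mul_left _ hpoly
          _ = 2 * (n + 1) * (4 ^ n * (n + 3)) := by ring
      have h3 : 2 * (n + 1) * ((2 * n + 3) * (2 * n + 1).choose (n + 1))
          ≤ 2 * (n + 1) * (4 ^ n * (n + 3)) := by
        calc 2 * (n + 1) * ((2 * n + 3) * (2 * n + 1).choose (n + 1))
            = (2 * n + 3) * (2 * (n + 1) * (2 * n + 1).choose (n + 1)) := by ring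
          _ ≤ (2 * n + 3) * (4 ^ n * (n + 2)) := h1
          _ ≤ 2 * (n + 1) * (4 ^ n * (n + 3)) := h2
      exact Nat.le_of_mul_le_mul_left h3 (by omega)
    calc 2 * (n + 1 + 1) * (2 * (n + 1) + 1).choose (n + 1 + 1)
        = 2 * ((n + 2) * (2 * (n + 1) + 1).choose (n + 1 + 1)) := by ring
      _ = 2 * ((2 * n + 3) * (2 * n + 2).choose (n + 1)) := by rw [hA]
      _ = 4 * ((2 * n + 3) * (2 * n + 1).choose (n + 1)) := by rw [hB]; ring
      _ ≤ 4 * (4 ^ n * (n + 3)) := Nat.mul_le_mul_left _ key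
      _ = 4 ^ (n + 1) * (n + 1 + 2) := by ring

/-! ### §2 Monotonicity of `C(q+k, j)/C(k+1, j)` in `k` -/

/-- For `q ≥ 1` and `k ≥ j + 1`: `C(q+k, j)·C(j+2, j) ≤ C(q+j+1, j)·C(k+1, j)` — the ratio `C(q+k, j)/C(k+1, j)` is
largest at `k = j + 1`. -/
lemma choose_ratio_le_of_succ_le (q j : ℕ) (hq : 1 ≤ q) :
    ∀ k, j + 1 ≤ k → (q + k).choose j * (j + 2).choose j ≤ (q + j + 1).choose j * (k + 1).choose j := by
  intro k hk
  induction k, hk using Nat.le_induction with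
  | base => rw [show q + (j + 1) = q + j + 1 by ring]
  | succ k hk ih =>
    rw [show q + (k + 1) = q + k + 1 by ring]
    have e1 := Nat.choose_mul_succ_eq (q + k) j
    have e2 := Nat.choose_mul_succ_eq (k + 1) j
    have hs : 1 ≤ q + k + 1 - j := by omega
    have hst : (k + 1 + 1 - j) * (q + k + 1) ≤ (q + k + 1 - j) * (k + 1 + 1) := by
      have hj1 : j ≤ k + 1 + 1 := by omega
      have hj2 : j ≤ q + k + 1 := by omega
      obtain ⟨t, ht⟩ := Nat.exists_eq_add_of_le hj1
      obtain ⟨s, hs'⟩ := Nat.exists_eq_add_of_le hj2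
      rw [show k + 1 + 1 - j = t by omega, show q + k + 1 - j = s by omega]
      nlinarith
    have h1 : (q + k + 1).choose j * (j + 2).choose j * ((q + k + 1 - j) * (k + 1 + 1))
        ≤ (q + j + 1).choose j * (k + 1 + 1).choose j * ((k + 1 + 1 - j) * (q + k + 1)) := by
      calc (q + k + 1).choose j * (j + 2).choose j * ((q + k + 1 - j) * (k + 1 + 1))
          = ((q + k + 1).choose j * (q + k + 1 - j)) * (j + 2).choose j * (k + 1 + 1) := by ring
        _ = ((q + k).choose j * (q + k + 1)) * (j + 2).choose j * (k + 1 + 1) := by rw [e1]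
        _ = ((q + k).choose j * (j + 2).choose j) * ((q + k + 1) * (k + 1 + 1)) := by ring
        _ ≤ ((q + j + 1).choose j * (k + 1).choose j) * ((q + k + 1) * (k + 1 + 1)) :=
            Nat.mul_le_mul_right _ ih
        _ = (q + j + 1).choose j * ((k + 1).choose j * (k + 1 + 1)) * (q + k + 1) := by ring
        _ = (q + j + 1).choose j * ((k + 1 + 1).choose j * (k + 1 + 1 - j)) * (q + k + 1) := by rw [e2]
        _ = (q + j + 1).choose j * (k + 1 + 1).choose j * ((k + 1 + 1 - j) * (q + k + 1)) := by ring
    have h2 : (q + k + 1).choose j * (j + 2).choose j * ((q + k + 1 - j) * (k + 1 + 1))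
        ≤ (q + j + 1).choose j * (k + 1 + 1).choose j * ((q + k + 1 - j) * (k + 1 + 1)) :=
      h1.trans (Nat.mul_le_mul_left _ hst)
    exact Nat.le_of_mul_le_mul_right h2 (by positivity)

end PercRepro
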